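import Summits.Parity.GeneralizedHardyLittlewood.Theorems.PrimeLevelFamEdgeMomentsBeyondDiagonalDiagBoseMixedRatio
import Summits.Parity.GeneralizedHardyLittlewood.Theorems.PrimeLevelFamEdgeMomentsBeyondDiagonalDiagBoseKernel2
import Summits.Parity.GeneralizedHardyLittlewood.Theorems.PrimeLevelFamEdgeMomentsBeyondDiagonalDiagBoseB0Tools
import HarnessLib

/-!
# Route `PrimeLevelFamEdge`, crux K_A `MomentsBeyondDiagonal` (stmt-Parity-20007), line «petersson_layers» v4, stub `stub_diag`:
# **census R2 — the shell profile `η·I_ab(η)` is a polynomial in `log(1/η)` up to `O(η(1+log(1/η))^{a+b+1})`**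

`…DiagBoseMixedShell.bose_coeff_sub_eq_integral_shell` reduces the Bose coefficient `c_ab` to the one-variable shell profile
`I_ab(η) = ∫_{u>0}(log u)^a(log(η/u))^b B(u+η/u) du/u`, `B(φ) = e^{−φ}(1−e^{−φ})^{−2}`. With `u = √η·v`:
`η·I_ab(η) = ∫_{v>0}(log√η + log v)^a(log√η − log v)^b · ηB(√η(v+1/v))/v dv`, and the kernel `k_η(v) = ηB(√η(v+1/v))/v`
satisfies `0 ≤ k_η ≤ k₀`, `|k_η − k₀| ≤ η/v` with the `η`-FREE model `k₀(v) = v/(1+v²)²` (from `B ≤ 1/φ²`, `|B − 1/φ²| ≤ 1`,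
`…DiagBoseKernel2`). Folding `(1,∞)` onto `(0,1)` by `v ↦ 1/v` (which preserves `k_η`, `k₀` and swaps `a ↔ b`):

* `shell_profile_model` — **`|η·I_ab(η) − ∫₀¹ S_ab(L, log v)·v/(1+v²)² dv| ≤ C·η·(1+L)^{a+b+1}`** for `0 < η ≤ 1`,
  `L = log(1/η)`, `S_ab(L,x) = (−L/2+x)^a(−L/2−x)^b + (−L/2−x)^a(−L/2+x)^b` — the model is a POLYNOMIAL in `L` of degree
  `a+b` with top coefficient `(−1)^{a+b}2^{−(a+b)}·2∫₀¹v/(1+v²)² = (−1)^{a+b}2^{−(a+b)}/2`.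

Integrating this in `η` through the shell identity gives `c_ab(y) = P_ab(log(1/y)) + r_ab(y)` with `|r_ab(y)| ≪ y(1+log(1/y))^{a+b+1}`
and `y·r_ab'(y)` equally small — the structure the corner/Abel step of the `stub_diag` assembly needs (next file).

Def-free; theorems only. Helper `--supports stmt-Parity-20007`; closes nothing; K_A, K_B and the Parity summit are NOT
proved; nothing about Landau–Siegel zeros.

## References
* E. Kowalski, P. Michel, J. VanderKam, J. reine angew. Math. 526 (2000), (22)–(28) pp. 12–15.
  [cite: KowalskiMichelVanderKam2000, (22)–(28) — derivation (residues of the diagonal weight, real-variable form)]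
-/

noncomputable section

open Real Set MeasureTheory Filter Function Finset

namespace Summit.Parity.GeneralizedHardyLittlewood.Theorems.MomentsBeyondDiagonal.DiagLines

/-! ## §1. Folding `(1,∞)` onto `(0,1)` -/

/-- `∫_{v>1} F(v) dv = ∫_{0<w<1} F(1/w) w^{−2} dw` (substitution `v = 1/w`; no integrability needed). [folklore] -/
theorem integral_Ioi_one_eq_integral_Ioo_inv (F : ℝ → ℝ) :
    ∫ v in Ioi (1 : ℝ), F v = ∫ w in Ioo (0 : ℝ) 1, F w⁻¹ / w ^ 2 := by
  have h := MeasureTheory.integral_comp_rpow_Ioi ((Ioi (1 : ℝ)).indicator F) (p := -1) (by norm_num)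
  rw [setIntegral_indicator measurableSet_Ioi, show Set.Ioi (0 : ℝ) ∩ Set.Ioi 1 = Set.Ioi 1 from
    inter_eq_right.2 (Ioi_subset_Ioi zero_le_one)] at h
  rw [← h]
  have hind : ∀ x ∈ Ioi (0 : ℝ), (|(-1 : ℝ)| * x ^ ((-1 : ℝ) - 1)) • (Ioi (1 : ℝ)).indicator F (x ^ (-1 : ℝ)) =
      (Ioo (0 : ℝ) 1).indicator (fun w ↦ F w⁻¹ / w ^ 2) x := by
    intro x hx
    have hx : 0 < x := hx
    rw [Real.rpow_neg_one, show ((-1 : ℝ) - 1) = -2 by norm_num, abs_neg, abs_one, one_mul, smul_eq_mul,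
      Real.rpow_neg hx.le, show (2 : ℝ) = (2 : ℕ) by norm_num, Real.rpow_natCast]
    by_cases h1 : x < 1
    · rw [indicator_of_mem (show x⁻¹ ∈ Ioi (1 : ℝ) from one_lt_inv_iff₀.2 ⟨hx, h1⟩),
        indicator_of_mem (show x ∈ Ioo (0 : ℝ) 1 from ⟨hx, h1⟩)]
      ring
    · rw [indicator_of_notMem (show x⁻¹ ∉ Ioi (1 : ℝ) from fun h ↦ h1 ((one_lt_inv_iff₀.1 h).2)),
        indicator_of_notMem (show x ∉ Ioo (0 : ℝ) 1 from fun h ↦ h1 h.2), mul_zero]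
  rw [setIntegral_congr_fun measurableSet_Ioi hind, setIntegral_indicator measurableSet_Ioo,
    show Set.Ioi (0 : ℝ) ∩ Set.Ioo 0 1 = Set.Ioo 0 1 from inter_eq_right.2 Ioo_subset_Ioi_self]

/-! ## §2. The substituted kernel against the model `v/(1+v²)²` -/

/-- `0 ≤ k_η(v) = ηB(√η(v+1/v))/v ≤ v/(1+v²)²` for `η, v > 0`. [folklore] -/
theorem shell_kernel_nonneg_le {η v : ℝ} (hη : 0 < η) (hv : 0 < v) :
    0 ≤ η * (Real.exp (-(Real.sqrt η * (v + v⁻¹))) / (1 - Real.exp (-(Real.sqrt η * (v + v⁻¹)))) ^ 2) / v ∧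
      η * (Real.exp (-(Real.sqrt η * (v + v⁻¹))) / (1 - Real.exp (-(Real.sqrt η * (v + v⁻¹)))) ^ 2) / v ≤
        v / (1 + v ^ 2) ^ 2 := by
  have hs : 0 < Real.sqrt η := Real.sqrt_pos.2 hη
  have hφ : 0 < v + v⁻¹ := by positivity
  have hx : 0 < Real.sqrt η * (v + v⁻¹) := mul_pos hs hφ
  refine ⟨by positivity, ?_⟩
  have hB := bose_kernel_le_inv_sq hx
  have hsq : (Real.sqrt η * (v + v⁻¹)) ^ 2 = η * (v + v⁻¹) ^ 2 := by rw [mul_pow, Real.sq_sqrt hη.le]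
  have hmodel : η * (1 / (Real.sqrt η * (v + v⁻¹)) ^ 2) / v = v / (1 + v ^ 2) ^ 2 := by
    rw [hsq]; field_simp; ring
  calc η * (Real.exp (-(Real.sqrt η * (v + v⁻¹))) / (1 - Real.exp (-(Real.sqrt η * (v + v⁻¹)))) ^ 2) / v
      ≤ η * (1 / (Real.sqrt η * (v + v⁻¹)) ^ 2) / v := by gcongr
    _ = v / (1 + v ^ 2) ^ 2 := hmodel

/-- `|k_η(v) − v/(1+v²)²| ≤ η/v` for `η, v > 0` (`|B(x) − 1/x²| ≤ 1`). [folklore] -/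
theorem abs_shell_kernel_sub_le {η v : ℝ} (hη : 0 < η) (hv : 0 < v) :
    |η * (Real.exp (-(Real.sqrt η * (v + v⁻¹))) / (1 - Real.exp (-(Real.sqrt η * (v + v⁻¹)))) ^ 2) / v -
      v / (1 + v ^ 2) ^ 2| ≤ η / v := by
  have hs : 0 < Real.sqrt η := Real.sqrt_pos.2 hη
  have hφ : 0 < v + v⁻¹ := by positivity
  have hx : 0 < Real.sqrt η * (v + v⁻¹) := mul_pos hs hφ
  have hB := abs_bose_kernel_sub_inv_sq_le hx
  have hsq : (Real.sqrt η * (v + v⁻¹)) ^ 2 = η * (v + v⁻¹) ^ 2 := by rw [mul_pow, Real.sq_sqrt hη.le]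
  have hmodel : v / (1 + v ^ 2) ^ 2 = η * (1 / (Real.sqrt η * (v + v⁻¹)) ^ 2) / v := by
    rw [hsq]; field_simp; ring
  rw [hmodel, ← sub_div, ← mul_sub, abs_div, abs_mul, abs_of_pos hη, abs_of_pos hv]
  calc η * |Real.exp (-(Real.sqrt η * (v + v⁻¹))) / (1 - Real.exp (-(Real.sqrt η * (v + v⁻¹)))) ^ 2 -
        1 / (Real.sqrt η * (v + v⁻¹)) ^ 2| / v ≤ η * 1 / v := by gcongr
    _ = η / v := by rw [mul_one]

/-- The model weight is dominated: `v/(1+v²)² ≤ 4/(1+v)²` for `v > 0`. [folklore] -/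
theorem model_weight_le {v : ℝ} (hv : 0 < v) : v / (1 + v ^ 2) ^ 2 ≤ 4 / (1 + v) ^ 2 := by
  rw [div_le_div_iff₀ (by positivity) (by positivity)]
  rcases le_or_gt v 1 with h1 | h1
  · nlinarith [sq_nonneg v, sq_nonneg (1 - v), mul_pos hv hv, sq_nonneg (v ^ 2)]
  · nlinarith [sq_nonneg v, sq_nonneg (v - 1), mul_pos hv hv, sq_nonneg (v ^ 2), sq_nonneg (v ^ 2 - v)]

/-! ## §3. The substitution `u = √η v` -/

/-- **`η·I_ab(η)` in the scaled variable.** For `η > 0`: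
`η ∫_{u>0}(log u)^a(log(η/u))^b B(u+η/u)/u du = ∫_{v>0}(log√η+log v)^a(log√η−log v)^b ηB(√η(v+1/v))/v dv`. [folklore] -/
theorem shell_profile_subst {η : ℝ} (hη : 0 < η) (a b : ℕ) :
    η * ∫ u in Ioi (0 : ℝ), Real.log u ^ a * Real.log (η / u) ^ b *
        (Real.exp (-(u + η / u)) / (1 - Real.exp (-(u + η / u))) ^ 2) / u =
      ∫ v in Ioi (0 : ℝ), (Real.log (Real.sqrt η) + Real.log v) ^ a * (Real.log (Real.sqrt η) - Real.log v) ^ b *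
        (η * (Real.exp (-(Real.sqrt η * (v + v⁻¹))) / (1 - Real.exp (-(Real.sqrt η * (v + v⁻¹)))) ^ 2) / v) := by
  set s : ℝ := Real.sqrt η with hs
  have hs0 : 0 < s := Real.sqrt_pos.2 hη
  have hss : s * s = η := Real.mul_self_sqrt hη.le
  set g : ℝ → ℝ := fun u ↦ Real.log u ^ a * Real.log (η / u) ^ b *
      (Real.exp (-(u + η / u)) / (1 - Real.exp (-(u + η / u))) ^ 2) / u with hg
  have hsub := MeasureTheory.integral_comp_mul_left_Ioi g 0 hs0
  rw [mul_zero, smul_eq_mul] at hsub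
  have h1 : ∫ u in Ioi (0 : ℝ), g u = s * ∫ v in Ioi (0 : ℝ), g (s * v) := by
    rw [hsub, ← mul_assoc, mul_inv_cancel₀ hs0.ne', one_mul]
  rw [h1, ← mul_assoc, ← integral_const_mul]
  refine setIntegral_congr_fun measurableSet_Ioi fun v hv ↦ ?_
  have hv : 0 < v := hv
  simp only [hg]
  have hsv : 0 < s * v := mul_pos hs0 hv
  have hdiv : η / (s * v) = s / v := by rw [← hss]; field_simp
  have harg : s * v + η / (s * v) = s * (v + v⁻¹) := by rw [hdiv]; field_simp
  rw [harg, hdiv, Real.log_mul hs0.ne' hv.ne', Real.log_div hs0.ne' hv.ne']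
  field_simp

/-! ## §4. The model estimate -/

-- one long real-variable assembly
set_option maxHeartbeats 800000 in
/-- **THE SHELL PROFILE IS A POLYNOMIAL IN `log(1/η)` UP TO `O(η(1+log(1/η))^{a+b+1})`.** For all `a, b` there is `C`
such that for `0 < η ≤ 1`, `L = log(1/η)`:
`|η∫_{u>0}(log u)^a(log(η/u))^b B(u+η/u) du/u − ∫_{0<v≤1} S_ab(L, log v)·v/(1+v²)² dv| ≤ C·η·(1+L)^{a+b+1}`,
`S_ab(L,x) = (−L/2+x)^a(−L/2−x)^b + (−L/2−x)^a(−L/2+x)^b`.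
[cite: KowalskiMichelVanderKam2000, (22)–(28) — derivation (one-variable profile of the residues of the diagonal weight)] -/
theorem shell_profile_model (a b : ℕ) : ∃ C : ℝ, ∀ η : ℝ, 0 < η → η ≤ 1 →
    |η * (∫ u in Ioi (0 : ℝ), Real.log u ^ a * Real.log (η / u) ^ b *
        (Real.exp (-(u + η / u)) / (1 - Real.exp (-(u + η / u))) ^ 2) / u) -
      ∫ v in Ioc (0 : ℝ) 1, ((-(Real.log (1 / η) / 2) + Real.log v) ^ a * (-(Real.log (1 / η) / 2) - Real.log v) ^ b +
          (-(Real.log (1 / η) / 2) - Real.log v) ^ a * (-(Real.log (1 / η) / 2) + Real.log v) ^ b) *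
        (v / (1 + v ^ 2) ^ 2)| ≤ C * η * (1 + Real.log (1 / η)) ^ (a + b + 1) := by
  set A₀ : ℝ := (max ((a + b : ℕ) : ℝ) 1) ^ (a + b) with hA₀
  have hA₀0 : 0 ≤ A₀ := by positivity
  refine ⟨1 + 2 ^ (2 * (a + b) + 1) * (1 + A₀), fun η hη0 hη1 ↦ ?_⟩
  -- notation
  set s : ℝ := Real.sqrt η with hs
  have hs0 : 0 < s := Real.sqrt_pos.2 hη0
  have hs1 : s ≤ 1 := (Real.sqrt_le_sqrt hη1).trans_eq Real.sqrt_one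
  have hsη : s ^ 2 = η := Real.sq_sqrt hη0.le
  set L : ℝ := Real.log (1 / η) with hL
  have hLdef : L = -Real.log η := by rw [hL, one_div, Real.log_inv]
  have hL0 : 0 ≤ L := by rw [hLdef]; have := Real.log_nonpos hη0.le hη1; linarith
  have hlogs : Real.log s = -(L / 2) := by rw [hs, Real.log_sqrt hη0.le, hLdef]; ring
  have habslogs : |Real.log s| = L / 2 := by rw [hlogs, abs_neg, abs_of_nonneg (by positivity)]
  set k : ℝ → ℝ := fun v ↦ η * (Real.exp (-(s * (v + v⁻¹))) / (1 - Real.exp (-(s * (v + v⁻¹)))) ^ 2) / v with hk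
  set k₀ : ℝ → ℝ := fun v ↦ v / (1 + v ^ 2) ^ 2 with hk₀
  set P : ℝ → ℝ := fun v ↦ (Real.log s + Real.log v) ^ a * (Real.log s - Real.log v) ^ b with hP
  set Pt : ℝ → ℝ := fun v ↦ (Real.log s - Real.log v) ^ a * (Real.log s + Real.log v) ^ b with hPt
  have hk_facts : ∀ v, 0 < v → 0 ≤ k v ∧ k v ≤ k₀ v ∧ |k v - k₀ v| ≤ η / v := fun v hv ↦
    ⟨(shell_kernel_nonneg_le hη0 hv).1, (shell_kernel_nonneg_le hη0 hv).2, abs_shell_kernel_sub_le hη0 hv⟩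
  have hk₀0 : ∀ v, 0 < v → 0 ≤ k₀ v := fun v hv ↦ by simp only [hk₀]; positivity
  -- the log factors
  have hPbd : ∀ v, 0 < v → |P v| ≤ (|Real.log s| + |Real.log v|) ^ (a + b) ∧
      |Pt v| ≤ (|Real.log s| + |Real.log v|) ^ (a + b) := by
    intro v hv
    have h1 : |Real.log s + Real.log v| ≤ |Real.log s| + |Real.log v| := abs_add_le _ _
    have h2 : |Real.log s - Real.log v| ≤ |Real.log s| + |Real.log v| := abs_sub _ _
    simp only [hP, hPt, abs_mul, abs_pow, pow_add]
    constructor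
    · gcongr
    · gcongr
  -- measurability
  have hsmeas : Measurable fun v : ℝ ↦ s * (v + v⁻¹) := measurable_const.mul (measurable_id.add measurable_inv)
  have hkmeas : Measurable k :=
    (measurable_const.mul ((Real.measurable_exp.comp hsmeas.neg).div
      ((measurable_const.sub (Real.measurable_exp.comp hsmeas.neg)).pow_const 2))).div measurable_id
  have hk₀meas : Measurable k₀ := measurable_id.div ((measurable_const.add (measurable_id.pow_const 2)).pow_const 2)
  have hPmeas : Measurable P :=
    ((measurable_const.add Real.measurable_log).pow_const a).mul ((measurable_const.sub Real.measurable_log).pow_const b)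
  have hPtmeas : Measurable Pt :=
    ((measurable_const.sub Real.measurable_log).pow_const a).mul ((measurable_const.add Real.measurable_log).pow_const b)
  -- domination by `(1+|log s|)^{a+b}·4(1+|log v|)^{a+b}/(1+v)²`
  have hJ := integrableOn_one_add_abs_log_pow_div_sq (a + b)
  set D : ℝ → ℝ := fun v ↦ (1 + |Real.log s|) ^ (a + b) * 4 * ((1 + |Real.log v|) ^ (a + b) / (1 + v) ^ 2) with hD
  have hD_int : IntegrableOn D (Ioi 0) := hJ.const_mul _
  have hlogfac : ∀ v : ℝ, (|Real.log s| + |Real.log v|) ^ (a + b) ≤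
      (1 + |Real.log s|) ^ (a + b) * (1 + |Real.log v|) ^ (a + b) := by
    intro v
    rw [← mul_pow]
    apply pow_le_pow_left₀ (by positivity)
    nlinarith [abs_nonneg (Real.log s), abs_nonneg (Real.log v)]
  have hdomk : ∀ F : ℝ → ℝ, (∀ v, 0 < v → |F v| ≤ (|Real.log s| + |Real.log v|) ^ (a + b)) → Measurable F →
      ∀ K : ℝ → ℝ, (∀ v, 0 < v → |K v| ≤ k₀ v) → Measurable K → IntegrableOn (fun v ↦ F v * K v) (Ioi 0) := by
    intro F hF hFm K hK hKm
    refine Integrable.mono' hD_int (hFm.mul hKm).aestronglyMeasurable ?_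
    rw [ae_restrict_iff' measurableSet_Ioi]
    refine ae_of_all _ fun v (hv : 0 < v) ↦ ?_
    rw [Real.norm_eq_abs, abs_mul]
    calc |F v| * |K v| ≤ (|Real.log s| + |Real.log v|) ^ (a + b) * k₀ v :=
          mul_le_mul (hF v hv) (hK v hv) (abs_nonneg _) (by positivity)
      _ ≤ ((1 + |Real.log s|) ^ (a + b) * (1 + |Real.log v|) ^ (a + b)) * (4 / (1 + v) ^ 2) :=
          mul_le_mul (hlogfac v) (model_weight_le hv) (hk₀0 v hv) (by positivity)
      _ = D v := by simp only [hD]; ring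
  have hkabs : ∀ v, 0 < v → |k v| ≤ k₀ v := fun v hv ↦ by
    rw [abs_of_nonneg (hk_facts v hv).1]; exact (hk_facts v hv).2.1
  have hk₀abs : ∀ v, 0 < v → |k₀ v| ≤ k₀ v := fun v hv ↦ (abs_of_nonneg (hk₀0 v hv)).le
  have hdabs : ∀ v, 0 < v → |k v - k₀ v| ≤ k₀ v := by
    intro v hv
    have h1 := (hk_facts v hv).1; have h2 := (hk_facts v hv).2.1
    rw [abs_sub_comm, abs_of_nonneg (by linarith)]; linarith
  have hPk_int : IntegrableOn (fun v ↦ P v * k v) (Ioi 0) := hdomk P (fun v hv ↦ (hPbd v hv).1) hPmeas k hkabs hkmeas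
  have hPtk_int : IntegrableOn (fun v ↦ Pt v * k v) (Ioi 0) := hdomk Pt (fun v hv ↦ (hPbd v hv).2) hPtmeas k hkabs hkmeas
  have hPd_int : IntegrableOn (fun v ↦ P v * (k v - k₀ v)) (Ioi 0) :=
    hdomk P (fun v hv ↦ (hPbd v hv).1) hPmeas _ hdabs (hkmeas.sub hk₀meas)
  have hPtd_int : IntegrableOn (fun v ↦ Pt v * (k v - k₀ v)) (Ioi 0) :=
    hdomk Pt (fun v hv ↦ (hPbd v hv).2) hPtmeas _ hdabs (hkmeas.sub hk₀meas)
  have hPk₀_int : IntegrableOn (fun v ↦ P v * k₀ v) (Ioi 0) := hdomk P (fun v hv ↦ (hPbd v hv).1) hPmeas k₀ hk₀abs hk₀meas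
  have hPtk₀_int : IntegrableOn (fun v ↦ Pt v * k₀ v) (Ioi 0) :=
    hdomk Pt (fun v hv ↦ (hPbd v hv).2) hPtmeas k₀ hk₀abs hk₀meas
  -- Step 1: substitution
  have hstep1 := shell_profile_subst hη0 a b
  have hstep1' : η * (∫ u in Ioi (0 : ℝ), Real.log u ^ a * Real.log (η / u) ^ b *
        (Real.exp (-(u + η / u)) / (1 - Real.exp (-(u + η / u))) ^ 2) / u) = ∫ v in Ioi (0 : ℝ), P v * k v := by
    rw [hstep1]
  -- Step 2: fold
  have hsplit : ∫ v in Ioi (0 : ℝ), P v * k v = (∫ v in Ioc (0 : ℝ) 1, P v * k v) + ∫ v in Ioi (1 : ℝ), P v * k v := by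
    rw [← Ioc_union_Ioi_eq_Ioi zero_le_one, setIntegral_union ?_ measurableSet_Ioi
      (hPk_int.mono_set Ioc_subset_Ioi_self) (hPk_int.mono_set (Ioi_subset_Ioi zero_le_one))]
    rw [Set.disjoint_left]; intro v h1 h2; exact absurd (mem_Ioi.1 h2) (not_lt.2 h1.2)
  have hfold : ∫ v in Ioi (1 : ℝ), P v * k v = ∫ v in Ioc (0 : ℝ) 1, Pt v * k v := by
    rw [integral_Ioi_one_eq_integral_Ioo_inv, ← integral_Ioc_eq_integral_Ioo]
    refine setIntegral_congr_fun measurableSet_Ioc fun w hw ↦ ?_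
    have hw : 0 < w := hw.1
    simp only [hP, hPt, hk]
    rw [Real.log_inv, inv_inv, add_comm w⁻¹ w]
    field_simp
    ring
  -- Step 3: main/error split on `(0,1]`
  have hIoc : ∀ {F : ℝ → ℝ}, IntegrableOn F (Ioi 0) → IntegrableOn F (Ioc 0 1) := fun h ↦ h.mono_set Ioc_subset_Ioi_self
  have hmain_eq : (∫ v in Ioc (0 : ℝ) 1, P v * k v) + (∫ v in Ioc (0 : ℝ) 1, Pt v * k v) -
      ∫ v in Ioc (0 : ℝ) 1, (P v + Pt v) * k₀ v =
      ∫ v in Ioc (0 : ℝ) 1, (P v * (k v - k₀ v) + Pt v * (k v - k₀ v)) := by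
    have hI1 : IntegrableOn (fun v ↦ P v * k v + Pt v * k v) (Ioc 0 1) := (hIoc hPk_int).add (hIoc hPtk_int)
    have hI2 : IntegrableOn (fun v ↦ (P v + Pt v) * k₀ v) (Ioc 0 1) :=
      ((hIoc hPk₀_int).add (hIoc hPtk₀_int)).congr_fun (fun v _ ↦ by
        show P v * k₀ v + Pt v * k₀ v = (P v + Pt v) * k₀ v; ring) measurableSet_Ioc
    rw [← integral_add (hIoc hPk_int) (hIoc hPtk_int), ← integral_sub hI1 hI2]
    refine setIntegral_congr_fun measurableSet_Ioc fun v _ ↦ ?_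
    ring
  -- the target in this notation
  have hgoalL : (∫ v in Ioc (0 : ℝ) 1, ((-(L / 2) + Real.log v) ^ a * (-(L / 2) - Real.log v) ^ b +
          (-(L / 2) - Real.log v) ^ a * (-(L / 2) + Real.log v) ^ b) * (v / (1 + v ^ 2) ^ 2)) =
      ∫ v in Ioc (0 : ℝ) 1, (P v + Pt v) * k₀ v := by
    simp only [hP, hPt, hk₀, hlogs]
  rw [hstep1', hsplit, hfold, hgoalL, hmain_eq]
  -- Step 4: the error integral, split at `s`
  have herr_int : IntegrableOn (fun v ↦ P v * (k v - k₀ v) + Pt v * (k v - k₀ v)) (Ioi 0) := hPd_int.add hPtd_int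
  have hsplit2 : ∫ v in Ioc (0 : ℝ) 1, (P v * (k v - k₀ v) + Pt v * (k v - k₀ v)) =
      (∫ v in Ioc (0 : ℝ) s, (P v * (k v - k₀ v) + Pt v * (k v - k₀ v))) +
        ∫ v in Ioc s 1, (P v * (k v - k₀ v) + Pt v * (k v - k₀ v)) := by
    rw [← Ioc_union_Ioc_eq_Ioc hs0.le hs1, setIntegral_union ?_ measurableSet_Ioc
      (herr_int.mono_set Ioc_subset_Ioi_self) (herr_int.mono_set fun v hv ↦ hs0.trans hv.1)]
    rw [Set.disjoint_left]; intro v h1 h2; exact absurd h2.1 (not_lt.2 h1.2)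
  rw [hsplit2]
  -- (i) the range `(0, s]`: `|P|,|Pt| ≤ (2|log v|)^{a+b}`, `|k − k₀| ≤ k₀ ≤ v`
  set Cs : ℝ := 2 * 2 ^ (a + b) * (2 ^ (a + b) * (|Real.log s| ^ (a + b) + A₀) * s) with hCs
  have hlow_ptw : ∀ v ∈ Ioc (0 : ℝ) s, ‖P v * (k v - k₀ v) + Pt v * (k v - k₀ v)‖ ≤ Cs := by
    intro v hv
    obtain ⟨hv0, hvs⟩ := hv
    have hv1 : v ≤ 1 := hvs.trans hs1
    have hls : |Real.log s| ≤ |Real.log v| := abs_log_le_abs_log hv0 hvs hs1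
    have hsum : (|Real.log s| + |Real.log v|) ^ (a + b) ≤ 2 ^ (a + b) * |Real.log v| ^ (a + b) := by
      rw [← mul_pow]; exact pow_le_pow_left₀ (by positivity) (by linarith) _
    have hk₀v : k₀ v ≤ v := by
      simp only [hk₀]
      rw [div_le_iff₀ (by positivity)]
      nlinarith [sq_nonneg v, sq_nonneg (v ^ 2)]
    have hd : |k v - k₀ v| ≤ v := (hdabs v hv0).trans hk₀v
    have hlv := abs_log_pow_mul_le (a + b) hv0 hvs hs1
    rw [Real.norm_eq_abs]
    calc |P v * (k v - k₀ v) + Pt v * (k v - k₀ v)|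
        ≤ |P v * (k v - k₀ v)| + |Pt v * (k v - k₀ v)| := abs_add_le _ _
      _ = (|P v| + |Pt v|) * |k v - k₀ v| := by
          rw [abs_mul (P v) (k v - k₀ v), abs_mul (Pt v) (k v - k₀ v)]; ring
      _ ≤ (2 ^ (a + b) * |Real.log v| ^ (a + b) + 2 ^ (a + b) * |Real.log v| ^ (a + b)) * v := by
          gcongr
          · exact (hPbd v hv0).1.trans hsum
          · exact (hPbd v hv0).2.trans hsum
      _ = 2 * 2 ^ (a + b) * (|Real.log v| ^ (a + b) * v) := by ring
      _ ≤ 2 * 2 ^ (a + b) * (2 ^ (a + b) * (|Real.log s| ^ (a + b) + (max ((a + b : ℕ) : ℝ) 1) ^ (a + b)) * s) := by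
          gcongr
      _ = Cs := by rw [hCs, hA₀]
  have hlow : |∫ v in Ioc (0 : ℝ) s, (P v * (k v - k₀ v) + Pt v * (k v - k₀ v))| ≤ Cs * s := by
    have h := norm_setIntegral_le_of_norm_le_const (μ := volume) (measure_Ioc_lt_top (a := (0 : ℝ)) (b := s)) hlow_ptw
    rw [Real.norm_eq_abs, Real.volume_real_Ioc_of_le hs0.le, sub_zero] at h
    exact h
  -- (ii) the range `(s, 1]`: `|P|,|Pt| ≤ L^{a+b}`, `|k − k₀| ≤ η/v`
  have hmid_int : IntegrableOn (fun v : ℝ ↦ 2 * L ^ (a + b) * η * (Real.log v ^ 0 / v)) (Ioc s 1) := by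
    refine ContinuousOn.integrableOn_Icc ?_ |>.mono_set Ioc_subset_Icc_self
    refine continuousOn_const.mul (ContinuousOn.div (continuousOn_const) continuousOn_id fun v hv ↦ ?_)
    exact ne_of_gt (hs0.trans_le hv.1)
  have hmid_ptw : ∀ v ∈ Ioc s 1, ‖P v * (k v - k₀ v) + Pt v * (k v - k₀ v)‖ ≤
      2 * L ^ (a + b) * η * (Real.log v ^ 0 / v) := by
    intro v hv
    obtain ⟨hsv, hv1⟩ := hv
    have hv0 : 0 < v := hs0.trans hsv
    have hlv : |Real.log v| ≤ |Real.log s| := abs_log_le_abs_log hs0 hsv.le hv1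
    have hsum : (|Real.log s| + |Real.log v|) ^ (a + b) ≤ L ^ (a + b) := by
      apply pow_le_pow_left₀ (by positivity); rw [habslogs] at hlv ⊢; linarith
    have hd : |k v - k₀ v| ≤ η / v := (hk_facts v hv0).2.2
    rw [Real.norm_eq_abs, pow_zero]
    calc |P v * (k v - k₀ v) + Pt v * (k v - k₀ v)|
        ≤ |P v * (k v - k₀ v)| + |Pt v * (k v - k₀ v)| := abs_add_le _ _
      _ = (|P v| + |Pt v|) * |k v - k₀ v| := by
          rw [abs_mul (P v) (k v - k₀ v), abs_mul (Pt v) (k v - k₀ v)]; ring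
      _ ≤ (L ^ (a + b) + L ^ (a + b)) * (η / v) := by
          gcongr
          · exact (hPbd v hv0).1.trans hsum
          · exact (hPbd v hv0).2.trans hsum
      _ = 2 * L ^ (a + b) * η * (1 / v) := by ring
  have hmid : |∫ v in Ioc s 1, (P v * (k v - k₀ v) + Pt v * (k v - k₀ v))| ≤ 2 * L ^ (a + b) * η * (L / 2) := by
    have h := norm_integral_le_of_norm_le hmid_int ((ae_restrict_iff' measurableSet_Ioc).2 (ae_of_all _ hmid_ptw))
    rw [Real.norm_eq_abs] at h
    have hval : ∫ v in Ioc s 1, 2 * L ^ (a + b) * η * (Real.log v ^ 0 / v) = 2 * L ^ (a + b) * η * (L / 2) := by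
      rw [integral_const_mul, ← intervalIntegral.integral_of_le hs1, integral_log_pow_div_eq 0 hs0 hs1, hlogs]
      ring
    exact h.trans hval.le
  -- assemble
  have hLs : |Real.log s| ^ (a + b) ≤ (1 + L) ^ (a + b) := by
    rw [habslogs]; exact pow_le_pow_left₀ (by positivity) (by linarith) _
  have hCs_le : Cs * s ≤ 2 ^ (2 * (a + b) + 1) * (1 + A₀) * η * (1 + L) ^ (a + b + 1) := by
    rw [hCs]
    have h1 : |Real.log s| ^ (a + b) + A₀ ≤ (1 + A₀) * (1 + L) ^ (a + b) := by
      have : A₀ ≤ A₀ * (1 + L) ^ (a + b) := le_mul_of_one_le_right hA₀0 (one_le_pow₀ (by linarith))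
      nlinarith
    have h2 : (1 + L) ^ (a + b) ≤ (1 + L) ^ (a + b + 1) := pow_le_pow_right₀ (by linarith) (by omega)
    calc 2 * 2 ^ (a + b) * (2 ^ (a + b) * (|Real.log s| ^ (a + b) + A₀) * s) * s
        = 2 ^ (2 * (a + b) + 1) * (|Real.log s| ^ (a + b) + A₀) * s ^ 2 := by ring
      _ ≤ 2 ^ (2 * (a + b) + 1) * ((1 + A₀) * (1 + L) ^ (a + b)) * s ^ 2 := by gcongr
      _ ≤ 2 ^ (2 * (a + b) + 1) * ((1 + A₀) * (1 + L) ^ (a + b + 1)) * s ^ 2 := by gcongr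
      _ = 2 ^ (2 * (a + b) + 1) * (1 + A₀) * η * (1 + L) ^ (a + b + 1) := by rw [hsη]; ring
  have hmid_le : 2 * L ^ (a + b) * η * (L / 2) ≤ 1 * η * (1 + L) ^ (a + b + 1) := by
    have : L ^ (a + b) * L = L ^ (a + b + 1) := by ring
    have h2 : L ^ (a + b + 1) ≤ (1 + L) ^ (a + b + 1) := pow_le_pow_left₀ hL0 (by linarith) _
    nlinarith [hη0.le, pow_nonneg hL0 (a + b + 1)]
  calc |(∫ v in Ioc (0 : ℝ) s, (P v * (k v - k₀ v) + Pt v * (k v - k₀ v))) +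
        ∫ v in Ioc s 1, (P v * (k v - k₀ v) + Pt v * (k v - k₀ v))|
      ≤ |∫ v in Ioc (0 : ℝ) s, (P v * (k v - k₀ v) + Pt v * (k v - k₀ v))| +
        |∫ v in Ioc s 1, (P v * (k v - k₀ v) + Pt v * (k v - k₀ v))| := abs_add_le _ _
    _ ≤ Cs * s + 2 * L ^ (a + b) * η * (L / 2) := add_le_add hlow hmid
    _ ≤ 2 ^ (2 * (a + b) + 1) * (1 + A₀) * η * (1 + L) ^ (a + b + 1) + 1 * η * (1 + L) ^ (a + b + 1) :=
        add_le_add hCs_le hmid_le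
    _ = (1 + 2 ^ (2 * (a + b) + 1) * (1 + A₀)) * η * (1 + L) ^ (a + b + 1) := by ring

end Summit.Parity.GeneralizedHardyLittlewood.Theorems.MomentsBeyondDiagonal.DiagLines

end
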